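import Summits.Langlands.Langlands.Theses.RationalPeriodQuarter
import Summits.Langlands.Langlands.Theorems.RationalPeriodQuarterHeckeFieldOfCruxes

/-!
# `RationalPeriodQuarter.Assembly` (stmt-Langlands-2813) — proved

The route's `Assembly` item
`RationalPeriodClassesQuarter → PeriodClassNontrivialQuarter → SemiAnalyticRigidity → HeckePreservesRationalPeriods →
 RationalEigencharacterLemma → ArtinMatchingFromHeckeField → QuarterSectorToSummit → Langlands`
follows from the route's deciding theorem `closes` with its glue binder `h₅ : HeckeFieldOfCruxes` discharged by the
landed `rationalPeriodQuarter_heckeFieldOfCruxes` (stmt-Langlands-10432; the `RationalEigencharacterLemma` hypothesis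
is not even needed any more — it is the proved stmt-2809 used inside child B).  Registry hygiene: count-neutral.
-/

set_option linter.dupNamespace false

namespace Summit.Langlands.Langlands.Theorems

open Summit.Langlands.Langlands.Theses.RationalPeriodQuarter in
/-- `RationalPeriodQuarter.Assembly` (stmt-Langlands-2813). -/
theorem rationalPeriodQuarter_assembly :
    Summit.Langlands.Langlands.Theses.RationalPeriodQuarter.Assembly :=
  fun h₁ h₂ h₃ h₄ _ h₆ h₇ => closes h₁ h₂ h₃ h₄ rationalPeriodQuarter_heckeFieldOfCruxes h₆ h₇

end Summit.Langlands.Langlands.Theorems
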